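/-
Copyright (c) 2026 the pub-hodgecm-mathlib formalisation cell (harness21).  Prover seat hodgecm-mathlib-K2Liu-p01 (g7), Track B «K2-LIT»,
#184♮ = hLiu418 = `stmt-HodgeConjecture-24832`; LEAD F0P6-plan (g13) «=» 2026-09-04T10:11:36Z (2) (n1) after ★ p859254 S5-F2.  #42S payer road, organ S5, letter (n1).
-/
import Summits.HodgeConjecture.HodgeConjecture.Theorems.K2LiuSiegelUnipotentFourierDefs   -- ★ Φ1 (D): `skewMatrices`, `mem_skewMatrices_iff`
import Literature.NumberTheory.Automorphic.QuadraticHeckeCharacterCM                      -- ★ `cmQuadraticGenerator`, `cmQuadraticGenerator_spec`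
import HarnessLib

/-!
# Crux `HLiu418`, #42S payer road, organ S5, letter (n1): THE RANK-ONE INDEX DICTIONARY — at `n = 1` the Fourier index group `Skew_T(L)` is the line `L⁺·α` of
# purely imaginary elements (`α² = θ`), the index VALUE `val X ∈ L⁺` with `X = val X · α`, `val X ≠ 0 ↔ X ≠ 0`, and the pairing `X·B = (val X)(val B)·θ`

Cell `hodgecm-mathlib`, crux item hLiu418 = `stmt-HodgeConjecture-24832` (helper lane `--supports … --as helper`, count-neutral).  THEOREMS ONLY (no `def`, no instance,
no notation, no named-fact hypothesis, no `sorry`).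

★ S5-F2 `K2LiuRankOneCentralVanishing` takes BY VALUE an index-value map `val : M_n(L) → L⁺` with `hval : X ∈ Skew_T(L) → X ≠ 0 → val X ≠ 0`, read against ★ W2's `(S, T)`
currency («`a_v` represents `val X`»).  At `n = 1` (the doubled hermitian LINE, S5's case) the `T`-skew condition `T X + σ(X)ᵀ T = 0` on a `1 × 1` matrix is `x + x̄ = 0` (`T₀₀ ≠ 0`),
i.e. `X₀₀` is purely imaginary, `X₀₀ = t·α` with `t ∈ L⁺` for the purely imaginary root `α` of ★ `cmQuadraticGenerator_spec` (`α ≠ 0`, `ᾱ = −α`, `α² = θ`).  The explicit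
σ-LINEAR PROJECTION `x ↦ (x − x̄)·(2α)⁻¹` is `L⁺`-valued on ALL of `L` and recovers `t` on the purely imaginary line, so the consumer instantiates
`val := fun X => ⟨(X 0 0 − c (X 0 0)) · (2α)⁻¹, _⟩` (a term, no definition) and this file supplies its three letters:
* §1 `1 × 1` bookkeeping: `mem_skewMatrices_fin_one_iff` (`X ∈ Skew_T ↔ X₀₀ + σ X₀₀ = 0` when `T₀₀ ≠ 0` in a domain), `fin_one_eq_zero_iff`, `trace_mul_fin_one`.
* §2 the projection: `complexConj_imPart` (it is `c`-fixed, hence `∈ L⁺` by Mathlib `IsCMField.complexConj_eq_self_iff`), `imPart_mul_root_eq_self` (`x + x̄ = 0 ⇒ (x−x̄)(2α)⁻¹·α = x`),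
  `imPart_ne_zero` (`x ≠ 0`, `x + x̄ = 0 ⇒ (x−x̄)(2α)⁻¹ ≠ 0`), `imPart_real_mul_root` (`((t α) − c(t α))(2α)⁻¹ = t` for `t ∈ L⁺`).
* §3 **`hval_fin_one`** — the `hval` letter of ★ S5-F2 at `n = 1` for that `val`; **`skew_fin_one_eq_val_smul_root`** — `X = val X · α` entrywise; `mul_root_mul_mul_root`
  (`(t α)(b α) = (t b) θ` — the pairing `tr(X·B)` that ★ Φ1's `ψ_X(n(B)) = ψ_L(tr(X_𝔸 B))` evaluates: at `n = 1`, `ψ_X(n(b·α)) = ψ_L((val X)·b·θ)`, the dictionary W1-fin uses to read the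
  hermitian value off the index).
[MoeglinWaldspurger1995, I.2.6] [Shimura1997, §18.1] [Kudla1997, §2].
HONEST LABEL.  Count-neutral helper; `HC_CM` is proved only modulo the 7 printed citations (2 remaining named inputs: hLiu418 = `stmt-HodgeConjecture-24832`,
h413 = `stmt-HodgeConjecture-24833`) until rung 0 closes.

## References
* [MoeglinWaldspurger1995] C. Mœglin, J.-L. Waldspurger, *Spectral decomposition and Eisenstein series*, CUP (1995), I.2.6.
* [Shimura1997] G. Shimura, *Euler Products and Eisenstein Series*, CBMS 93 (1997), §18.1 (Fourier expansion along the Siegel unipotent, hermitian indices).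
* [Kudla1997] S. Kudla, *Central derivatives of Eisenstein series and height pairings*, Ann. of Math. 146 (1997), §2 (rank one: indices `t ∈ F`).
-/

set_option autoImplicit false
set_option linter.dupNamespace false -- the mandated namespace repeats `HodgeConjecture.HodgeConjecture`

noncomputable section

open scoped Matrix
open NumberField IsDedekindDomain
open Literature.NumberTheory.Automorphic
open Summit.HodgeConjecture.HodgeConjecture.Cruxes.HLiu418.K2LiuSiegelUnipotentFourierDefs

namespace Summit.HodgeConjecture.HodgeConjecture.Cruxes.HLiu418.K2LiuRankOneIndexValue

/-! ## §1 `1 × 1` bookkeeping -/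

section FinOne

variable {R : Type*} [CommRing R]

/-- a `1 × 1` matrix vanishes iff its entry does. [folklore] -/
theorem fin_one_eq_zero_iff (X : Matrix (Fin 1) (Fin 1) R) : X = 0 ↔ X 0 0 = 0 := by
  constructor
  · intro h; rw [h]; rfl
  · intro h
    ext i j
    rw [Subsingleton.elim i 0, Subsingleton.elim j 0, h]
    rfl

/-- the trace of a product of `1 × 1` matrices is the product of the entries (the pairing `tr(X·B)` of ★ Φ1's `unipDeltaChar` at `n = 1`). [folklore] -/
theorem trace_mul_fin_one (X B : Matrix (Fin 1) (Fin 1) R) : (X * B).trace = X 0 0 * B 0 0 := by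
  rw [Matrix.trace_fin_one, Matrix.mul_apply, Fin.sum_univ_one]

/-- entry `(0,0)` of `T X + σ(X)ᵀ T` for `1 × 1` matrices: `T₀₀ · (X₀₀ + σ X₀₀)`. [folklore] -/
theorem skew_lhs_fin_one (σ : R →+* R) (T X : Matrix (Fin 1) (Fin 1) R) :
    (T * X + (X.map σ)ᵀ * T) 0 0 = T 0 0 * (X 0 0 + σ (X 0 0)) := by
  simp only [Matrix.add_apply, Matrix.mul_apply, Fin.sum_univ_one, Matrix.transpose_apply, Matrix.map_apply]
  ring

/-- **the `T`-skew condition at `n = 1`**: for `T₀₀` a non-zero-divisor (e.g. `≠ 0` in a domain), `X ∈ Skew_T ↔ X₀₀ + σ(X₀₀) = 0` («`X₀₀` is purely imaginary»).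
[cite: Shimura1997, §18.1] -/
theorem mem_skewMatrices_fin_one_iff [NoZeroDivisors R] (σ : R →+* R) {T : Matrix (Fin 1) (Fin 1) R} (hT : T 0 0 ≠ 0) (X : Matrix (Fin 1) (Fin 1) R) :
    X ∈ skewMatrices σ T ↔ X 0 0 + σ (X 0 0) = 0 := by
  rw [mem_skewMatrices_iff, fin_one_eq_zero_iff, skew_lhs_fin_one, mul_eq_zero, or_iff_right hT]

end FinOne

/-! ## §2 The σ-linear projection `x ↦ (x − x̄)(2α)⁻¹` onto the coordinate along the purely imaginary root -/

section Projection

variable (L : Type) [Field L] [NumberField L] [IsCMField L]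

/-- **the projection is `c`-fixed**: `c((x − c x)(2α)⁻¹) = (x − c x)(2α)⁻¹` for `c α = −α` — so it lies in `L⁺` (Mathlib `IsCMField.complexConj_eq_self_iff`). [folklore] -/
theorem complexConj_imPart {α : L} (hαc : IsCMField.complexConj L α = -α) (x : L) :
    IsCMField.complexConj L ((x - IsCMField.complexConj L x) * (2 * α)⁻¹) = (x - IsCMField.complexConj L x) * (2 * α)⁻¹ := by
  rw [map_mul, map_inv₀, map_mul, map_sub, IsCMField.complexConj_apply_apply, hαc, map_ofNat]
  rw [show (2 : L) * -α = -(2 * α) by ring, inv_neg, mul_neg, ← neg_mul, neg_sub]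

/-- membership form: `(x − c x)(2α)⁻¹ ∈ L⁺`. [folklore] -/
theorem imPart_mem {α : L} (hαc : IsCMField.complexConj L α = -α) (x : L) :
    (x - IsCMField.complexConj L x) * (2 * α)⁻¹ ∈ maximalRealSubfield L :=
  (IsCMField.complexConj_eq_self_iff (K := L) _).1 (complexConj_imPart L hαc x)

/-- **on the purely imaginary line the projection is the coordinate**: `x + c x = 0 ⇒ ((x − c x)(2α)⁻¹)·α = x` (`α ≠ 0`). [folklore] -/
theorem imPart_mul_root_eq_self {α : L} (hα0 : α ≠ 0) {x : L} (hx : x + IsCMField.complexConj L x = 0) :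
    (x - IsCMField.complexConj L x) * (2 * α)⁻¹ * α = x := by
  have hc : IsCMField.complexConj L x = -x := eq_neg_of_add_eq_zero_right hx
  rw [hc, sub_neg_eq_add, ← two_mul]
  field_simp

/-- **non-vanishing**: `x ≠ 0`, `x + c x = 0` ⇒ `(x − c x)(2α)⁻¹ ≠ 0`. [folklore] -/
theorem imPart_ne_zero {α : L} (hα0 : α ≠ 0) {x : L} (hx0 : x ≠ 0) (hx : x + IsCMField.complexConj L x = 0) :
    (x - IsCMField.complexConj L x) * (2 * α)⁻¹ ≠ 0 := by
  intro h
  have h' := imPart_mul_root_eq_self L hα0 hx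
  rw [h, zero_mul] at h'
  exact hx0 h'.symm

/-- **the projection of `t·α` is `t`** for `t ∈ L⁺` (`c t = t`, `c α = −α`, `α ≠ 0`). [folklore] -/
theorem imPart_real_mul_root {α : L} (hα0 : α ≠ 0) (hαc : IsCMField.complexConj L α = -α) (t : ↥(maximalRealSubfield L)) :
    ((algebraMap ↥(maximalRealSubfield L) L t * α) - IsCMField.complexConj L (algebraMap ↥(maximalRealSubfield L) L t * α)) * (2 * α)⁻¹ =
      algebraMap ↥(maximalRealSubfield L) L t := by
  rw [map_mul, AlgEquiv.commutes, hαc, mul_neg, sub_neg_eq_add, ← mul_two, mul_inv, mul_assoc, mul_assoc,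
    show (2 : L) * (2⁻¹ * α⁻¹) = α⁻¹ by rw [← mul_assoc, mul_inv_cancel₀ (two_ne_zero), one_mul], mul_inv_cancel₀ hα0, mul_one]

/-- `t·α` is purely imaginary for `t ∈ L⁺`. [folklore] -/
theorem real_mul_root_add_conj {α : L} (hαc : IsCMField.complexConj L α = -α) (t : ↥(maximalRealSubfield L)) :
    algebraMap ↥(maximalRealSubfield L) L t * α + IsCMField.complexConj L (algebraMap ↥(maximalRealSubfield L) L t * α) = 0 := by
  rw [map_mul, AlgEquiv.commutes, hαc, mul_neg, add_neg_cancel]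

omit [NumberField L] [IsCMField L] in
/-- **the pairing**: `(t α)(b α) = (t b)·θ` for `α² = θ` (`tr(X·B)` of two `T`-skew `1 × 1` matrices `X = tα`, `B = bα`). [cite: Shimura1997, §18.1] [cite: Kudla1997, §2] -/
theorem mul_root_mul_mul_root {α θ : L} (hsq : α ^ 2 = θ) (t b : L) : (t * α) * (b * α) = (t * b) * θ := by
  rw [← hsq]; ring

end Projection

/-! ## §3 The `hval` letter of ★ S5-F2 at `n = 1` -/

section Val

variable (L : Type) [Field L] [NumberField L] [IsCMField L]

/-- **`X = val X · α` ENTRYWISE ON `Skew_T(L)` AT `n = 1`**: for `T₀₀ ≠ 0` and `X` `T`-skew, `X₀₀ = ((X₀₀ − c X₀₀)(2α)⁻¹)·α`. [cite: Shimura1997, §18.1] -/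
theorem skew_fin_one_eq_val_mul_root {α : L} (hα0 : α ≠ 0) {T : Matrix (Fin 1) (Fin 1) L} (hT : T 0 0 ≠ 0) {X : Matrix (Fin 1) (Fin 1) L}
    (hX : X ∈ skewMatrices ((IsCMField.complexConj L : L ≃ₐ[↥(maximalRealSubfield L)] L) : L →+* L) T) :
    X 0 0 = (X 0 0 - IsCMField.complexConj L (X 0 0)) * (2 * α)⁻¹ * α := by
  have hx : X 0 0 + IsCMField.complexConj L (X 0 0) = 0 :=
    (mem_skewMatrices_fin_one_iff ((IsCMField.complexConj L : L ≃ₐ[↥(maximalRealSubfield L)] L) : L →+* L) hT X).1 hX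
  exact (imPart_mul_root_eq_self L hα0 hx).symm

/-- **THE `hval` LETTER AT `n = 1`**: with `val X := ⟨(X₀₀ − c X₀₀)(2α)⁻¹, _⟩ ∈ L⁺`, every non-zero `T`-skew `X` has `val X ≠ 0` (`T₀₀ ≠ 0`: e.g. ★ `gramR` of a non-degenerate line).
[cite: Shimura1997, §18.1] [cite: Kudla1997, §2] -/
theorem hval_fin_one {α : L} (hα0 : α ≠ 0) (hαc : IsCMField.complexConj L α = -α) {T : Matrix (Fin 1) (Fin 1) L} (hT : T 0 0 ≠ 0) :
    ∀ X ∈ skewMatrices ((IsCMField.complexConj L : L ≃ₐ[↥(maximalRealSubfield L)] L) : L →+* L) T, X ≠ 0 →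
      (⟨(X 0 0 - IsCMField.complexConj L (X 0 0)) * (2 * α)⁻¹, imPart_mem L hαc (X 0 0)⟩ : ↥(maximalRealSubfield L)) ≠ 0 := by
  intro X hX hX0 h
  have h' : (X 0 0 - IsCMField.complexConj L (X 0 0)) * (2 * α)⁻¹ = 0 := congrArg Subtype.val h
  have hx : X 0 0 + IsCMField.complexConj L (X 0 0) = 0 :=
    (mem_skewMatrices_fin_one_iff ((IsCMField.complexConj L : L ≃ₐ[↥(maximalRealSubfield L)] L) : L →+* L) hT X).1 hX
  have hx0 : X 0 0 ≠ 0 := fun h0 => hX0 ((fin_one_eq_zero_iff X).2 h0)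
  exact imPart_ne_zero L hα0 hx0 hx h'

/-- conversely every `t ∈ L⁺` gives the `T`-skew index `t·α` (as a `1 × 1` matrix) — the index group at `n = 1` IS `L⁺·α ≅ L⁺` (`N_Δ(L⁺)\N_Δ(𝔸) ≅ L⁺\𝔸_{L⁺}`).
[cite: Kudla1997, §2] [cite: MoeglinWaldspurger1995, I.2.6] -/
theorem real_mul_root_mem_skewMatrices {α : L} (hαc : IsCMField.complexConj L α = -α) (T : Matrix (Fin 1) (Fin 1) L) (t : ↥(maximalRealSubfield L)) :
    Matrix.of (fun _ _ : Fin 1 => algebraMap ↥(maximalRealSubfield L) L t * α) ∈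
      skewMatrices ((IsCMField.complexConj L : L ≃ₐ[↥(maximalRealSubfield L)] L) : L →+* L) T := by
  rw [mem_skewMatrices_iff, fin_one_eq_zero_iff, skew_lhs_fin_one]
  show T 0 0 * (algebraMap ↥(maximalRealSubfield L) L t * α + IsCMField.complexConj L (algebraMap ↥(maximalRealSubfield L) L t * α)) = 0
  rw [real_mul_root_add_conj L hαc t, mul_zero]

/-- and its value is `t`. [cite: Kudla1997, §2] -/
theorem val_real_mul_root {α : L} (hα0 : α ≠ 0) (hαc : IsCMField.complexConj L α = -α) (t : ↥(maximalRealSubfield L)) :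
    (⟨((Matrix.of (fun _ _ : Fin 1 => algebraMap ↥(maximalRealSubfield L) L t * α)) 0 0 -
          IsCMField.complexConj L ((Matrix.of (fun _ _ : Fin 1 => algebraMap ↥(maximalRealSubfield L) L t * α)) 0 0)) * (2 * α)⁻¹,
        imPart_mem L hαc _⟩ : ↥(maximalRealSubfield L)) = t := by
  apply Subtype.ext
  show ((algebraMap ↥(maximalRealSubfield L) L t * α) - IsCMField.complexConj L (algebraMap ↥(maximalRealSubfield L) L t * α)) * (2 * α)⁻¹ = (t : L)
  exact imPart_real_mul_root L hα0 hαc t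

end Val

end Summit.HodgeConjecture.HodgeConjecture.Cruxes.HLiu418.K2LiuRankOneIndexValue

end
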